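import Literature.Topology.FourManifolds.MMSWPictureCompression
import Literature.Topology.FourManifolds.MMSWPictureDottedTubes
import Literature.Topology.FourManifolds.CircleTubeUniqueness
import Literature.Topology.FourManifolds.BlowDownFlatModel
import HarnessLib

/-!
# The pieces of the model identification: hole points, virtual points, outer core points

Topic `Literature/Topology/FourManifolds`; part of the proof of the named fact
`Literature.Topology.FourManifolds.pictureSurgeryPresentation` (`MMSWPictureSurgery.lean`; Kirby,
*The Topology of 4-Manifolds*, LNM 1374 (1989), Ch. I §2, Lemma 2.1).  Everything here is proved;
no named fact is introduced.

Working in the complex coordinates `p = (z, w) ∈ ℂ × ℂ` of `ℝ⁴`, we define the three maps out of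
which the identification `M_k ∖ K → Y` of `MMSWPictureSurgery` is assembled, and prove how they fit:

* `bPt k fl j p ∈ ℝ² × 𝕊¹`, the point of the `j`-th glued-in solid torus attached to `(z, w)` near
  the `j`-th core: disc coordinate `w̄`, circle coordinate the direction of `z − c_j` (reflected by
  `planeFlip` when the flag `fl j` records that the thin tube of the dotted circle is the reflected
  round tube);
* `virtS k η p ∈ 𝕊³`, the virtual sphere point `σ_N⁻¹ (cpt (Z_mod(z, w)) (w̄/|w|))`;
* `outS k p ∈ 𝕊³`, the outer core point `outerPt (y/|y|) (squeeze ½ w̄)`.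

Main results: near the `j`-th core and off it, the virtual point is the thin round tube point
`dottedTubeFun k j (w̄/|w̄|, |w| · dir)` (`virtS_eq_dottedTubeFun`), so that the glue relation of
the surgery identifies `JA (virtS p)` with `JB j (bPt j p)`; in the far zone and off the core the
virtual point IS the outer core point (`coe_virtS_eq_outVec`); and the three maps are smooth where
they are used (`contMDiffAt_bPt`, `contMDiffAt_virtS`, `contMDiffAt_outS`).

## References

* R. Kirby, *The Topology of 4-Manifolds*, LNM 1374 (1989), Ch. I §2. [Kirby1989]
-/

open scoped Manifold ContDiff Topology Real ComplexConjugate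
open Function Set Metric

noncomputable section

namespace Literature.Topology.FourManifolds

/-- Local notation: `𝔼 n` is the model Euclidean space `EuclideanSpace ℝ (Fin n)`. -/
local notation "𝔼 " n:arg => EuclideanSpace ℝ (Fin n)
/-- Local notation: `𝕊 n` is the unit sphere of `EuclideanSpace ℝ (Fin (n + 1))`. -/
local notation "𝕊 " n:arg => (Metric.sphere (0 : EuclideanSpace ℝ (Fin (n + 1))) 1)

namespace MMSW

open Literature.AlgebraicTopology.Homotopy.HopfFibration (zC wC)

variable {k : ℕ} {η : ℝ}

/-! ## Reflection flags on the circle -/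

/-- The optional plane reflection. [folklore] -/
def flipE (b : Bool) (v : 𝔼 2) : 𝔼 2 := bif b then planeFlip v else v

/-- The optional reflection of the unit circle. [folklore] -/
def flipS (b : Bool) (u : 𝕊 1) : 𝕊 1 :=
  ⟨flipE b u, by
    rw [mem_sphere_zero_iff_norm]
    cases b
    · exact norm_eq_of_mem_sphere u
    · change ‖planeFlip u‖ = 1
      rw [norm_planeFlip]; exact norm_eq_of_mem_sphere u⟩

/-- The value of `flipS`. [folklore] -/
@[simp] theorem coe_flipS (b : Bool) (u : 𝕊 1) : (flipS b u : 𝔼 2) = flipE b u := rfl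

/-- The optional reflection is an involution. [folklore] -/
@[simp] theorem flipE_flipE (b : Bool) (v : 𝔼 2) : flipE b (flipE b v) = v := by
  cases b
  · rfl
  · exact planeFlip_planeFlip v

/-- The optional reflection is linear: it commutes with scalars. [folklore] -/
theorem flipE_smul (b : Bool) (t : ℝ) (v : 𝔼 2) : flipE b (t • v) = t • flipE b v := by
  cases b
  · rfl
  · exact planeFlip.map_smul t v

/-- The optional reflection preserves norms. [folklore] -/
@[simp] theorem norm_flipE (b : Bool) (v : 𝔼 2) : ‖flipE b v‖ = ‖v‖ := by
  cases b
  · rfl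
  · exact norm_planeFlip v

/-- The optional reflection is smooth. [folklore] -/
theorem contDiff_flipE (b : Bool) : ContDiff ℝ ∞ (flipE b) := by
  cases b
  · exact contDiff_id
  · exact planeFlip.contDiff

/-- The optional reflection of the circle is smooth. [folklore] -/
theorem contMDiff_flipS (b : Bool) : ContMDiff (𝓡 1) (𝓡 1) ∞ (flipS b) := by
  haveI : Fact (Module.finrank ℝ (𝔼 2) = 1 + 1) := ⟨finrank_euclideanSpace_fin⟩
  exact ((contDiff_flipE b).contMDiff.comp contMDiff_coe_sphere).codRestrict_sphere _

/-! ## The solid-torus point attached to `(z, w)` near the `j`-th core -/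

/-- The direction of `z − c_j` as a point of the circle (junk at `z = c_j`). [folklore] -/
def holeDirS (k : ℕ) (j : Fin k) (z : ℂ) : 𝕊 1 :=
  radialProjection (circlePoint 0) (toE2 (z - holeCentre k j))

/-- Off the pole the direction is `u_{c_j}(z)`. [folklore] -/
theorem coe_holeDirS {j : Fin k} {z : ℂ} (hz : z ≠ holeCentre k j) :
    (holeDirS k j z : 𝔼 2) = toE2 (unitDir (holeCentre k j) z) := by
  have h0 : toE2 (z - holeCentre k j) ≠ 0 := by
    rw [Ne, toE2_eq_zero_iff, sub_eq_zero]; exact hz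
  rw [holeDirS, coe_radialProjection_of_ne_zero _ h0, unitDir, norm_toE2, ← Complex.real_smul,
    ← toE2_toC (‖z - holeCentre k j‖⁻¹ • toE2 (z - holeCentre k j))]
  congr 1
  apply Complex.ext <;> simp [toC, toE2]

/-- **The solid-torus point** `b_j(z, w) = (w̄, flip_j (dir (z − c_j)))`. [folklore] -/
def bPt (k : ℕ) (fl : Fin k → Bool) (j : Fin k) (p : ℂ × ℂ) : 𝔼 2 × 𝕊 1 :=
  (toE2 (conj p.2), flipS (fl j) (holeDirS k j p.1))

/-- The disc coordinate of `b_j` has norm `|w|`. [folklore] -/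
@[simp] theorem norm_bPt_fst (fl : Fin k → Bool) (j : Fin k) (p : ℂ × ℂ) :
    ‖(bPt k fl j p).1‖ = ‖p.2‖ := by
  rw [bPt, norm_toE2, Complex.norm_conj]

/-- `b_j` is smooth off the pole. [folklore] -/
theorem contMDiffAt_bPt (fl : Fin k → Bool) {j : Fin k} {p : ℂ × ℂ} (hz : p.1 ≠ holeCentre k j) :
    ContMDiffAt 𝓘(ℝ, ℂ × ℂ) (𝓘(ℝ, 𝔼 2).prod (𝓡 1)) ∞ (bPt k fl j) p := by
  have h1 : ContMDiffAt 𝓘(ℝ, ℂ × ℂ) 𝓘(ℝ, 𝔼 2) ∞ (fun p : ℂ × ℂ ↦ toE2 (conj p.2)) p :=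
    (contDiff_toE2.comp (Complex.conjCLE.contDiff.comp contDiff_snd)).contMDiff.contMDiffAt
  have h0 : toE2 (p.1 - holeCentre k j) ≠ 0 := by
    rw [Ne, toE2_eq_zero_iff, sub_eq_zero]; exact hz
  have h2 : ContMDiffAt 𝓘(ℝ, ℂ × ℂ) (𝓡 1) ∞ (fun p : ℂ × ℂ ↦ holeDirS k j p.1) p :=
    (contMDiffAt_radialProjection' (circlePoint 0) h0).comp p
      (contDiff_toE2.comp (contDiff_fst.sub contDiff_const)).contMDiff.contMDiffAt
  exact h1.prodMk ((contMDiff_flipS (fl j)).contMDiffAt.comp p h2)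

/-! ## The virtual sphere point -/

/-- The virtual chart point `cpt (Z_mod(z, w)) (w̄/|w|)`. [folklore] -/
def virtC (k : ℕ) (η : ℝ) (p : ℂ × ℂ) : (ℝ × ℝ) × ℝ := cpt k (zmod k η p) (conj (unitDir 0 p.2))

/-- **The virtual sphere point** `σ_N⁻¹ (cpt (Z_mod(z, w)) (w̄/|w|))`. [folklore] -/
def virtS (k : ℕ) (η : ℝ) (p : ℂ × ℂ) : 𝕊 3 := stereoNorthInv (virtC k η p)

/-- The coordinates of the virtual sphere point. [folklore] -/
theorem coe_virtS (p : ℂ × ℂ) : (virtS k η p : 𝔼 4) = stereoNorthInvCoe (virtC k η p) := rfl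

/-- The virtual point is smooth on `{w ≠ 0} × {z ∉ poles, |z| < 50(k+1)}`. [folklore] -/
theorem contMDiffAt_virtS {p : ℂ × ℂ} (hw : p.2 ≠ 0) (hz : ∀ i : Fin k, p.1 ≠ holeCentre k i)
    (hz' : ‖p.1‖ < 50 * ((k : ℝ) + 1)) :
    ContMDiffAt 𝓘(ℝ, ℂ × ℂ) (𝓡 3) ∞ (virtS k η) p := by
  have hu : ContDiffAt ℝ ∞ (fun p : ℂ × ℂ ↦ conj (unitDir 0 p.2)) p :=
    Complex.conjCLE.contDiff.comp_contDiffAt p ((contDiffAt_unitDir hw).comp p contDiffAt_snd)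
  have hC : ContDiffAt ℝ ∞ (virtC k η) p :=
    (contDiff_cpt k).contDiffAt.comp p ((contDiffAt_zmod hw hz hz').prodMk hu)
  exact contMDiff_stereoNorthInv.contMDiffAt.comp p hC.contMDiffAt

/-! ## The thin round tube point, from the virtual point -/

/-- `w̄ = |w| · conj (u_0(w))`. [folklore] -/
theorem conj_eq_norm_mul (w : ℂ) : conj w = ((‖w‖ : ℝ) : ℂ) * conj (unitDir 0 w) := by
  have h := eq_centre_add_norm_mul_unitDir 0 w
  rw [zero_add, sub_zero] at h
  conv_lhs => rw [h]
  rw [map_mul, Complex.conj_ofReal]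

/-- The squeeze of `|w| · d`, `|d| = 1`, is `ρ(|w|) · d`. [folklore] -/
theorem squeeze_norm_smul {d : 𝔼 2} (hd : ‖d‖ = 1) (m : ℝ) (hm : 0 ≤ m) :
    squeeze (1 / 2) (m • d) = thinRad m • d := by
  rw [squeeze_def, squeezeFactor_def, norm_smul, Real.norm_of_nonneg hm, hd, mul_one, smul_smul,
    thinRad]
  congr 1
  have := (Real.sqrt_pos.2 (by positivity) : 0 < Real.sqrt (1 + m ^ 2))
  field_simp

/-- **Near the `j`-th core, off it, the virtual point is a thin round tube point**:
for `z` in the inner annulus about `c_j`, `g(z) ≥ 1 − η` (`η > 0`) and `w ≠ 0`,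
`virtS (z, w) = dottedTubeFun k j (w̄/|w̄|, |w| · dir (z − c_j))`. [folklore] -/
theorem virtS_eq_dottedTubeFun (hη : 0 < η) {j : Fin k} {p : ℂ × ℂ}
    (hz : p.1 ∈ annulus (holeCentre k j) (1 / 2) (27 / 20)) (hg : 1 - η ≤ planarPot k p.1)
    (hw : p.2 ≠ 0) :
    virtS k η p = dottedTubeFun k j
      (radialProjection (circlePoint 0) (toE2 (conj p.2)), ‖p.2‖ • (holeDirS k j p.1 : 𝔼 2)) := by
  obtain ⟨θ, hθ⟩ := circlePoint_surjective (radialProjection (circlePoint 0) (toE2 (conj p.2)))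
  have hzj : p.1 ≠ holeCentre k j := ne_centre_of_mem_annulus (by norm_num) hz
  have hm : 0 < ‖p.2‖ := norm_pos_iff.2 hw
  -- the direction `w̄/|w|` in coordinates
  have hcw : toE2 (conj p.2) ≠ 0 := by
    rw [Ne, toE2_eq_zero_iff, map_eq_zero]; exact hw
  have hdir : ((circlePoint θ : 𝕊 1) : 𝔼 2) = toE2 (conj (unitDir 0 p.2)) := by
    rw [hθ, coe_radialProjection_of_ne_zero _ hcw, norm_toE2, Complex.norm_conj, conj_eq_norm_mul,
      ← toE2_toC (‖p.2‖⁻¹ • toE2 _)]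
    congr 1
    apply Complex.ext
    · simp [toC, toE2, hm.ne']
    · simp [toC, toE2, hm.ne']
  have hcos : Real.cos θ = (conj (unitDir 0 p.2)).re := by
    have := congrArg (fun v : 𝔼 2 ↦ v 0) hdir
    simpa [circlePoint_apply_zero, toE2] using this
  have hsin : Real.sin θ = (conj (unitDir 0 p.2)).im := by
    have := congrArg (fun v : 𝔼 2 ↦ v 1) hdir
    simpa [circlePoint_apply_one, toE2] using this
  -- the virtual point
  have hχ : cutoff η (planarPot k p.1) = 1 := cutoff_eq_one hη hg
  have hzmod : zmod k η p = holeCentre k j + ((thinRad ‖p.2‖ : ℝ) : ℂ) * unitDir (holeCentre k j) p.1 := by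
    rw [zmod_of_near_eq_ray hz, hχ]; simp
  rw [← hθ, dottedTubeFun_circlePoint, virtS]
  congr 1
  rw [virtC, hzmod, coe_holeDirS hzj, squeeze_norm_smul (by rw [norm_toE2, norm_unitDir hzj]) _ hm.le,
    cpt, cylPt]
  simp only [Complex.add_re, Complex.add_im, Complex.mul_re, Complex.mul_im, Complex.ofReal_re,
    Complex.ofReal_im, zero_mul, sub_zero, add_zero, PiLp.smul_apply, smul_eq_mul, hcos, hsin,
    dottedRadius, holeCentre, toE2, Matrix.cons_val_zero, Matrix.cons_val_one, Matrix.cons_val_fin_one]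
  ring_nf

/-! ## The outer core point -/

/-- The outer core vector `outerPt (y/|y|) (squeeze ½ w̄) ∈ ℝ⁴`. [folklore] -/
def outVec (k : ℕ) (p : ℂ × ℂ) : 𝔼 4 :=
  outerPt k (coLatDir k p.1) (squeeze (1 / 2) (toE2 (conj p.2)))

/-- The outer core vector made total on the sphere: junk value the north pole on the focus.
[folklore] -/
def outVecS (k : ℕ) (p : ℂ × ℂ) : 𝔼 4 :=
  if coLat k p.1 ≠ 0 then outVec k p else ((northPole : 𝕊 3) : 𝔼 4)

/-- The squeezed disc coordinate is short: `|squeeze ½ w̄| < 1/2`. [folklore] -/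
theorem norm_squeeze_half_lt (v : 𝔼 2) : ‖squeeze (1 / 2) v‖ < 1 / 2 := norm_squeeze_lt one_half_pos v

/-- `outVecS` lies on the unit sphere. [folklore] -/
theorem outVecS_mem (p : ℂ × ℂ) : outVecS k p ∈ Metric.sphere (0 : 𝔼 4) 1 := by
  rw [mem_sphere_zero_iff_norm, outVecS]
  split_ifs with h
  · exact norm_outerPt (norm_coLatDir h) (by linarith [norm_squeeze_half_lt (toE2 (conj p.2))])
  · exact norm_eq_of_mem_sphere _

/-- **The outer core point** of the sphere. [folklore] -/
def outS (k : ℕ) : ℂ × ℂ → 𝕊 3 := Set.codRestrict (outVecS k) _ outVecS_mem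

/-- Off the focus the outer core point is the outer core vector. [folklore] -/
theorem coe_outS {p : ℂ × ℂ} (h : coLat k p.1 ≠ 0) : (outS k p : 𝔼 4) = outVec k p := by
  rw [outS, val_codRestrict_apply, outVecS, if_pos h]

/-- The co-latitude vector is smooth. [folklore] -/
theorem contDiff_coLat (k : ℕ) : ContDiff ℝ ∞ (coLat k) := by
  have hre : ContDiff ℝ ∞ fun z : ℂ ↦ z.re := Complex.reCLM.contDiff
  have him : ContDiff ℝ ∞ fun z : ℂ ↦ z.im := Complex.imCLM.contDiff
  have hden : ContDiff ℝ ∞ (outerDen k) := by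
    unfold outerDen; exact ((hre.add contDiff_const).pow 2 |>.add (him.pow 2)).add contDiff_const
  have hden0 : ∀ z, outerDen k z ≠ 0 := fun z ↦ (outerDen_pos z).ne'
  rw [contDiff_euclidean]
  intro i
  fin_cases i
  · exact (contDiff_const.mul him).div hden hden0
  · exact (((hre.add contDiff_const).pow 2 |>.add (him.pow 2)).sub contDiff_const).div hden hden0

/-- The co-latitude direction is smooth off the focus. [folklore] -/
theorem contDiffAt_coLatDir {z : ℂ} (hz : coLat k z ≠ 0) : ContDiffAt ℝ ∞ (coLatDir k) z := by
  unfold coLatDir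
  exact (((contDiff_coLat k).contDiffAt.norm ℝ hz).inv (norm_ne_zero_iff.2 hz)).smul
    (contDiff_coLat k).contDiffAt

/-- The outer core vector is smooth off the focus. [folklore] -/
theorem contDiffAt_outVec {p : ℂ × ℂ} (h : coLat k p.1 ≠ 0) : ContDiffAt ℝ ∞ (outVec k) p := by
  have h1 : ContDiffAt ℝ ∞ (fun p : ℂ × ℂ ↦ (coLatDir k p.1, squeeze (1 / 2) (toE2 (conj p.2)))) p :=
    ((contDiffAt_coLatDir h).comp p contDiffAt_fst).prodMk
      (((contDiff_squeeze _).comp (contDiff_toE2.comp (Complex.conjCLE.contDiff.comp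
        contDiff_snd))).contDiffAt)
  have h2 : ContDiffAt ℝ ∞ (fun q : 𝔼 2 × 𝔼 2 ↦ outerPt k q.1 q.2)
      (coLatDir k p.1, squeeze (1 / 2) (toE2 (conj p.2))) :=
    contDiffAt_outerPt (q := (coLatDir k p.1, squeeze (1 / 2) (toE2 (conj p.2))))
      (norm_coLatDir h) (by linarith [norm_squeeze_half_lt (toE2 (conj p.2))])
  have h3 := h2.comp p h1
  exact h3

/-- **The outer core point is smooth off the focus.** [folklore] -/
theorem contMDiffAt_outS {p : ℂ × ℂ} (h : coLat k p.1 ≠ 0) :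
    ContMDiffAt 𝓘(ℝ, ℂ × ℂ) (𝓡 3) ∞ (outS k) p := by
  haveI : Fact (Module.finrank ℝ (𝔼 4) = 3 + 1) := ⟨finrank_euclideanSpace_fin⟩
  have hO : IsOpen {q : ℂ × ℂ | coLat k q.1 ≠ 0} :=
    isOpen_ne.preimage ((contDiff_coLat k).continuous.comp continuous_fst)
  have hf : ContMDiffOn 𝓘(ℝ, ℂ × ℂ) 𝓘(ℝ, 𝔼 4) ∞ (outVecS k) {q : ℂ × ℂ | coLat k q.1 ≠ 0} := by
    intro q hq
    refine ((contDiffAt_outVec hq).contMDiffAt.congr_of_eventuallyEq ?_).contMDiffWithinAt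
    filter_upwards [hO.mem_nhds hq] with q' hq'
    rw [outVecS, if_pos hq']
  exact (BlowDownFlat.contMDiffOn_codRestrict_sphere_of_isOpen hO hf outVecS_mem p h).contMDiffAt
    (hO.mem_nhds h)

/-! ## In the far zone the virtual point is the outer core point -/

/-- `toE2` commutes with real scalars. [folklore] -/
theorem toE2_real_mul (m : ℝ) (v : ℂ) : toE2 ((m : ℂ) * v) = m • toE2 v := by
  ext i
  fin_cases i <;> simp [toE2]

/-- **In the far zone, off the core, the virtual point is the outer core point** (as vectors):
for `18(k+1) ≤ |z| < C_k`, `g(z) ≥ 1 − η` (`η > 0`) and `w ≠ 0`. [folklore] -/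
theorem coe_virtS_eq_outVec (hη : 0 < η) {p : ℂ × ℂ} (hz : 18 * ((k : ℝ) + 1) ≤ ‖p.1‖)
    (hz' : ‖p.1‖ < drawRadius k) (hg : 1 - η ≤ planarPot k p.1) (hw : p.2 ≠ 0) :
    (virtS k η p : 𝔼 4) = outVec k p := by
  have hχ := cutoff_eq_one hη hg
  obtain ⟨hzmod, -⟩ := zmod_of_far_eq_outerZ (η := η) hz hz' hw
  rw [hχ, one_mul, sub_self, zero_mul, add_zero] at hzmod
  have hρ0 : 0 < thinRad ‖p.2‖ := thinRad_pos (norm_pos_iff.2 hw)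
  have hρ1 : thinRad ‖p.2‖ < 1 := by linarith [thinRad_lt_half ‖p.2‖]
  have hco : coLat k p.1 ≠ 0 := coLat_ne_zero_of_lt_norm (by linarith) hz'
  have he : ‖coLatDir k p.1‖ = 1 := norm_coLatDir hco
  have hd : ‖toE2 (conj (unitDir 0 p.2))‖ = 1 := by
    rw [norm_toE2, Complex.norm_conj, norm_unitDir hw]
  have hsq : squeeze (1 / 2) (toE2 (conj p.2)) = thinRad ‖p.2‖ • toE2 (conj (unitDir 0 p.2)) := by
    rw [conj_eq_norm_mul p.2, toE2_real_mul, squeeze_norm_smul hd _ (norm_nonneg _)]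
  rw [coe_virtS, virtC, hzmod, outVec, hsq]
  have h1 := outerPt_coLatDir_latS (k := k) (outerZ k (coLatDir k p.1) (thinRad ‖p.2‖)) hd
  rw [coLatDir_outerZ he hρ0 hρ1, latS_outerZ he hρ0 hρ1.le] at h1
  rw [h1, cpt]
  congr 1
  generalize outerZ k (coLatDir k p.1) (thinRad ‖p.2‖) = Z
  simp only [Complex.re_ofReal_mul, Complex.im_ofReal_mul]
  rfl

/-- In the far zone, off the core, the virtual point is the outer core point. [folklore] -/
theorem virtS_eq_outS (hη : 0 < η) {p : ℂ × ℂ} (hz : 18 * ((k : ℝ) + 1) ≤ ‖p.1‖)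
    (hz' : ‖p.1‖ < drawRadius k) (hg : 1 - η ≤ planarPot k p.1) (hw : p.2 ≠ 0) :
    virtS k η p = outS k p := by
  have hk : (0 : ℝ) ≤ k := Nat.cast_nonneg k
  have hco : coLat k p.1 ≠ 0 := coLat_ne_zero_of_lt_norm (by linarith) hz'
  exact Subtype.ext (by rw [coe_virtS_eq_outVec hη hz hz' hg hw, coe_outS hco])

end MMSW

end Literature.Topology.FourManifolds
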